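import Summits.QuantumFields.YangMills.Theorems.FluctuationComparisonRegPrIntLS2BetaPosCollarOfGrowthRow
import Summits.QuantumFields.YangMills.Theorems.FluctuationComparisonRegPrIntLS2BetaTubeGrowthOfIsolated
import Summits.QuantumFields.YangMills.Theorems.FluctuationComparisonRegPrIntLWregFibredChart
import HarnessLib

/-!
# S2β · POS∘ — THE TAYLOR HALF (T2b): THE COVER ROW for the tube chart docked on a fibred chart, and POS∘ ∕ TUBE♭ from the growth row along `y ↦ Φ (V, σ y)`

Cell `ym3-torus` (YM ladder rung R3 = continuum `SU(2)` Yang–Mills on the three-torus at fixed lattice data — a RUNG: NOT d = 4, NOT infinite volume,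
NOT a mass gap, NOT Clay).  Width seat `ym3-torus-px21` (gen 18); pen named by px8 g18; (T1) `…S2BetaGrowthOfHessianPos` (HESS∘ ⟹ growth row), (T2a) `…S2BetaPosCollarOfGrowthRow`
(orbit-distance letters + abstract collar).  Crux `stmt-QuantumFields-20520` (`…Theses.UnitScaleTilt.FluctuationComparisonRegPrIntL`), LINE g18-1 S2β;
`--kind proof --supports stmt-QuantumFields-20520 --as helper`, count-neutral, DEFINITION-FREE (0 `def`, 0 `instance`, 0 `notation`, 0 `sorry`, default heartbeats).

WHY.  (T2a)'s abstract collar displays a COVER row: «for every neighbourhood `s` of `0` there is `r > 0` such that every point of `closure (fibre V ∩ histGood)` at orbit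
distance `≤ r` from the residual orbit of `U₀` is `w • Ψ y` with `y ∈ s`, `w` residual».  THIS FILE proves it for the transversal of record `Ψ y := D.Φ (V, σ y)` — the
tubular transversal `σ` of the (C3β″) tube chart `Θ (z, y) := pivotAct (e z) (σ y)` through `U₀` (px21 g9–g17 ∕ ✓`exists_tubeRows`), re-solved into the fibre of `V` by a
fibred chart `Φ` (ABSTRACT: any map with the CLOSURE-FORM RECOGNITION row of w3-20520 g14's chart of record ✓`…ChartContLaplaceRows.exists_laplaceRows` :154 —
«`U' ∈ closure histGood → descendTo U' = V → (U' = z off the pivots) → Φ z = U'`» —, or a `ChartData` (✓`…WregAssembly`, recognition `ChartData.recog`)) — from displayed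
inputs: chart SURJECTIVITY near `U₀` (`𝓝 U₀ ≤ map Θ (𝓝 0)`, a row of ✓`exists_tubularHaarChart_pivotAct_local`) and the LOCAL row «`descendTo` is continuous at every point
near `U₀`» (✓`…MinimiserPin.continuousAt_descendTo_of_plaqLe`; for the `ChartData` edition also «`histGood ∈ 𝓝 U₀`», both discharged in the regime by (T2d)
`…S2BetaPosCollarLocalRows`).  Mechanism: (T2a) §2 puts `w•U` inside the neighbourhood `Θ '' (univ ×ˢ s) ∩ {continuity} (∩ N₀)`; there `w•U` is IN the fibre
(closure point + continuity of the descent), equals `pivotAct (w', h) (σ y)`, and `w'⁻¹•(w•U)` has `σ y`'s off-pivot coordinates and lies in `closure (fibre ∩ histGood)`,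
so RECOGNITION identifies it with `Φ (σ y)`.

WHAT.
* §1 `gaugeAct_inv_apply_of_apply_eq`, `mem_fibre_of_mem_closure_of_continuousAt`, `gaugeAct_mem_closure_inter` — letters.
* §2 ★★ `exists_transversal_repr` — the CORE: every point of `closure (fibre V ∩ histGood)` at small orbit distance is `v • W'` with `v` residual, `W'` in the fibre and in
  `closure (fibre V ∩ histGood)`, `W' = σ y` off the pivots (`y` in the prescribed neighbourhood), and a residual translate of `W'` inside any prescribed `N₀ ∈ 𝓝 U₀`.
* §3 ★★★ `cover_of_recog` — THE COVER ROW of (T2a) for `Ψ := Φ ∘ σ`, edition A (closure-form recognition, chart of record); ★★★ `cover_of_chartData` — edition B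
  (`D : ChartData`, `Ψ := D.Φ (V, σ ·)`, with `hopen` and the charted regime; bonus `D.jac (V, σ y) ≠ 0`).
* §4 ★★★ `posCollar_of_growthRow_of_recog` — px8's POS∘ letter (`hpos` of ✓`tubeGrowth_of_pos_of_isolated`, VERBATIM) ⟸ {growth row along `Φ ∘ σ`, differentiability of its
  matrix field at `0` (✓`contDiffAt_coeField_resolve`), recognition, the §3 inputs}; ★★★ `tubeGrowth_of_growthRow_of_isolated_of_recog` — TUBE♭(V, U₀) ⟸ {the same, ISOL∘(δ)}
  (✓px8 `tubeGrowth_of_pos_of_isolated` ∘ it).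

HONEST: topology∕bookkeeping over landed letters; the growth row (⟸ HESS∘ by (T1): print's (142) [Balaban1985Variational] p.299 — the constrained Hessian at print's regular
minimiser is positive mod residual gauge — NOT proved here) and ISOL∘(δ) are DISPLAYED; TUBE-REG∘, GAP♯∘, GAP♭, EXW∘, S2β, crux 20520 NOT proved; no summit statement is proved
by a helper; finite-volume ∕ conditional; rung R3 = SU(2) YM₃ on T³ — NOT d = 4, NOT infinite volume, NOT a mass gap, NOT Clay; the Yang–Mills mass gap is NOT proved.
Sorry-free, axioms standard.

References: T. Bałaban, CMP **102** (1985) 277–309 [Balaban1985Variational] (Thm 1 (8)–(10) p.279, (142) p.299); CMP **102** (1985) 255–275 [Balaban1985UV3] ((12)–(13) p.259,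
(18)–(22) p.260); CMP **109** (1987) 249–301 [Balaban1987RG1] ((0.4) p.253, (2.10) p.267); CMP **98** (1985) 17–51 [Balaban1985Averaging] ((8) p.19).
-/

set_option autoImplicit false

noncomputable section

namespace Summit.QuantumFields.YangMills.Theorems.FluctuationComparisonRegPrIntLS2BetaPosCollarCoverOfTubeChart

open Set Filter Topology Function
open scoped Matrix.Norms.L2Operator
open Literature.MathematicalPhysics.QuantumFieldTheory.Balaban1983to89
open Literature.MathematicalPhysics.QuantumFieldTheory.Balaban1983to89.T3ContinuumYM3Torus
open Literature.MathematicalPhysics.QuantumFieldTheory.Balaban1983to89.T3UnitLawDensityEML (ℰp)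
open Literature.MathematicalPhysics.QuantumFieldTheory.Balaban1983to89.T3UnitScaleTilt
open Literature.MathematicalPhysics.QuantumFieldTheory.Balaban1983to89.T3TiltDescent
open Literature.MathematicalPhysics.QuantumFieldTheory.Balaban1983to89.T3ConstrainedMinimiser (fibre)
open Literature.MathematicalPhysics.QuantumFieldTheory.Balaban1983to89.T3PrintedRegularMinimiser
open Literature.MathematicalPhysics.QuantumFieldTheory.Balaban1983to89.T4Continuum
open scoped Literature.MathematicalPhysics.QuantumFieldTheory.Balaban1983to89.T3OrbitAverage
open Literature.MathematicalPhysics.QuantumFieldTheory.Balaban1983to89.Node00 (coeField)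
open Summit.QuantumFields.YangMills.Theorems.FluctuationComparisonRegPrIntLWregChain (iterCentralBond iterCentralBond_injective chainWindow)
open Summit.QuantumFields.YangMills.Theorems.FluctuationComparisonRegPrIntLWregFibredChart (chainWindow_extend)
open Summit.QuantumFields.YangMills.Theorems.FluctuationComparisonRegPrIntLWregAssembly (ChartData histGood_subset_charted)
open Summit.QuantumFields.YangMills.Theorems.FluctuationComparisonRegPrIntLS2BetaResidualGauge
open Summit.QuantumFields.YangMills.Theorems.FluctuationComparisonRegPrIntLS2BetaResidualSubgroup
open Summit.QuantumFields.YangMills.Theorems.FluctuationComparisonRegPrIntLS2BetaPosCollarOfGrowthRow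
open Summit.QuantumFields.YangMills.Theorems.FluctuationComparisonRegPrIntLS2BetaTubeGrowthOfIsolated (tubeGrowth_of_pos_of_isolated)

variable (F : T3Family) {J K : ℕ} (hJK : J ≤ K)

/-! ## §1 Letters -/

section Letters

/-- If `W b = (u•X) b` at a bond then `(u⁻¹•W) b = X b` (the gauge formula reads one bond). [cite: Balaban1985Averaging, (8) p.19] -/
theorem gaugeAct_inv_apply_of_apply_eq {u : Site (F.P K) 0 → Matrix.specialUnitaryGroup (Fin 2) ℂ}
    {W X : GaugeField (F.P K) 0 (Matrix.specialUnitaryGroup (Fin 2) ℂ)} {b : PBond (F.P K) 0}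
    (h : W b = GaugeField.gaugeAct u X b) :
    GaugeField.gaugeAct (u⁻¹ : Site (F.P K) 0 → Matrix.specialUnitaryGroup (Fin 2) ℂ) W b = X b := by
  have h' : W b = u b.src * X b * (u b.tgt)⁻¹ := h
  show (u⁻¹ : Site (F.P K) 0 → Matrix.specialUnitaryGroup (Fin 2) ℂ) b.src * W b *
      ((u⁻¹ : Site (F.P K) 0 → Matrix.specialUnitaryGroup (Fin 2) ℂ) b.tgt)⁻¹ = X b
  rw [h', Pi.inv_apply, Pi.inv_apply, inv_inv]
  group

/-- A closure point of the fibre at which the descent is continuous lies in the fibre (`descendTo ⁻¹' {V}` is closed where `descendTo` is continuous).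
[cite: Balaban1987RG1, (0.11) p.253; Balaban1985Averaging, Prop. 2 p.26] -/
theorem mem_fibre_of_mem_closure_of_continuousAt {V : GaugeField (F.P J) 0 (Matrix.specialUnitaryGroup (Fin 2) ℂ)}
    {W : GaugeField (F.P K) 0 (Matrix.specialUnitaryGroup (Fin 2) ℂ)} (hW : W ∈ closure (fibre F ℰp J K hJK V))
    (hc : ContinuousAt (descendTo F ℰp J K hJK) W) : W ∈ fibre F ℰp J K hJK V := by
  have h1 : descendTo F ℰp J K hJK W ∈ closure (descendTo F ℰp J K hJK '' fibre F ℰp J K hJK V) :=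
    hc.continuousWithinAt.mem_closure_image hW
  have h2 : descendTo F ℰp J K hJK '' fibre F ℰp J K hJK V ⊆ {V} := by
    rintro _ ⟨U, hU, rfl⟩
    exact hU
  have h3 := closure_mono h2 h1
  rw [closure_singleton] at h3
  exact h3

/-- A residual transformation maps `closure (fibre V ∩ histGood)` into itself. [cite: Balaban1985Variational, (4) p.278; Balaban1985UV3, (7) p.257] -/
theorem gaugeAct_mem_closure_inter {θ : ℕ → ℝ} {w : Site (F.P K) 0 → Matrix.specialUnitaryGroup (Fin 2) ℂ}
    (hw : ∀ U : GaugeField (F.P K) 0 (Matrix.specialUnitaryGroup (Fin 2) ℂ),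
      descendTo F ℰp J K hJK (GaugeField.gaugeAct w U) = descendTo F ℰp J K hJK U)
    {V : GaugeField (F.P J) 0 (Matrix.specialUnitaryGroup (Fin 2) ℂ)} {U : GaugeField (F.P K) 0 (Matrix.specialUnitaryGroup (Fin 2) ℂ)}
    (hU : U ∈ closure (fibre F ℰp J K hJK V ∩ histGood F ℰp θ K J)) :
    GaugeField.gaugeAct w U ∈ closure (fibre F ℰp J K hJK V ∩ histGood F ℰp θ K J) := by
  have himg : (fun X : GaugeField (F.P K) 0 (Matrix.specialUnitaryGroup (Fin 2) ℂ) => GaugeField.gaugeAct w X) ''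
      (fibre F ℰp J K hJK V ∩ histGood F ℰp θ K J) ⊆ fibre F ℰp J K hJK V ∩ histGood F ℰp θ K J := by
    rintro _ ⟨X, ⟨hXf, hXh⟩, rfl⟩
    exact ⟨(gaugeAct_mem_fibre_iff_of_residual F hJK hw X V).2 hXf, (gaugeAct_mem_histGood_iff F w θ J X).2 hXh⟩
  exact closure_mono himg (image_closure_subset_closure_image (continuous_gaugeAct_right F w) ⟨U, hU, rfl⟩)

end Letters

/-! ## §2 The core: a transversal representative of every near-orbit point of the closed good fibre -/

section Core

variable {θ : ℕ → ℝ}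

/-- ★★ **THE CORE OF THE COVER.**  Tube chart `Θ (z, y) := pivotAct (e z) (σ y)` through `U₀` with the surjectivity row `𝓝 U₀ ≤ map Θ (𝓝 0)`; `descendTo` continuous near `U₀`.
Then for every neighbourhood `s` of `0` and every `N₀ ∈ 𝓝 U₀` there is `r > 0` such that every `U ∈ closure (fibre V ∩ histGood)` at orbit distance `≤ r` is `v • W'` with `v`
residual, `W' ∈ fibre V ∩ closure (fibre V ∩ histGood)`, `W' b = σ y b` off the pivots for some `y ∈ s`, and `u • W' ∈ N₀` for a residual `u`.
[cite: Balaban1985Variational, Thm 1 (8)-(10) p.279; Balaban1987RG1, (0.4) p.253; Balaban1985UV3, (12)-(13) p.259] -/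
theorem exists_transversal_repr {V : GaugeField (F.P J) 0 (Matrix.specialUnitaryGroup (Fin 2) ℂ)} {U₀ : GaugeField (F.P K) 0 (Matrix.specialUnitaryGroup (Fin 2) ℂ)}
    (hcont : ∀ᶠ W in 𝓝 U₀, ContinuousAt (descendTo F ℰp J K hJK) W)
    {Z Y : Type*} [TopologicalSpace Z] [Zero Z] [TopologicalSpace Y] [Zero Y]
    (e : Z → ↥(residualSubgroup F hJK) × (PBond (F.P K) (K - J) → Matrix.specialUnitaryGroup (Fin 2) ℂ))
    (σ : Y → GaugeField (F.P K) 0 (Matrix.specialUnitaryGroup (Fin 2) ℂ))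
    (hΘ : 𝓝 U₀ ≤ map (fun p : Z × Y => pivotAct F hJK (iterCentralBond (P := F.P K) (K - J)) (e p.1) (σ p.2)) (𝓝 0))
    {N₀ : Set (GaugeField (F.P K) 0 (Matrix.specialUnitaryGroup (Fin 2) ℂ))} (hN₀ : N₀ ∈ 𝓝 U₀) :
    ∀ s ∈ 𝓝 (0 : Y), ∃ r : ℝ, 0 < r ∧
      ∀ U ∈ closure (fibre F ℰp J K hJK V ∩ histGood F ℰp θ K J),
        (⨅ w' : {w : Site (F.P K) 0 → Matrix.specialUnitaryGroup (Fin 2) ℂ |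
            ∀ U : GaugeField (F.P K) 0 (Matrix.specialUnitaryGroup (Fin 2) ℂ),
              descendTo F ℰp J K hJK (GaugeField.gaugeAct w U) = descendTo F ℰp J K hJK U},
          ∑ ℓ : PBond (F.P K) 0,
            dist1 (U ℓ * ((GaugeField.gaugeAct (w' : Site (F.P K) 0 → Matrix.specialUnitaryGroup (Fin 2) ℂ) U₀) ℓ)⁻¹) ^ 2) ≤ r →
        ∃ y ∈ s, ∃ v : Site (F.P K) 0 → Matrix.specialUnitaryGroup (Fin 2) ℂ,
          (∀ U'' : GaugeField (F.P K) 0 (Matrix.specialUnitaryGroup (Fin 2) ℂ),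
              descendTo F ℰp J K hJK (GaugeField.gaugeAct v U'') = descendTo F ℰp J K hJK U'') ∧
          ∃ W' : GaugeField (F.P K) 0 (Matrix.specialUnitaryGroup (Fin 2) ℂ),
            U = GaugeField.gaugeAct v W' ∧ W' ∈ fibre F ℰp J K hJK V ∧ W' ∈ closure (fibre F ℰp J K hJK V ∩ histGood F ℰp θ K J) ∧
            (∀ b : PBond (F.P K) 0, (∀ c, iterCentralBond (P := F.P K) (K - J) c ≠ b) → W' b = σ y b) ∧
            ∃ u : Site (F.P K) 0 → Matrix.specialUnitaryGroup (Fin 2) ℂ,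
              (∀ U'' : GaugeField (F.P K) 0 (Matrix.specialUnitaryGroup (Fin 2) ℂ),
                  descendTo F ℰp J K hJK (GaugeField.gaugeAct u U'') = descendTo F ℰp J K hJK U'') ∧
              GaugeField.gaugeAct u W' ∈ N₀ := by
  classical
  intro s hs
  -- the image of `univ ×ˢ s` under the tube chart is a neighbourhood of `U₀`
  have hT : (fun p : Z × Y => pivotAct F hJK (iterCentralBond (P := F.P K) (K - J)) (e p.1) (σ p.2)) '' (univ ×ˢ s) ∈ 𝓝 U₀ :=
    hΘ (image_mem_map (prod_mem_nhds univ_mem hs))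
  -- the neighbourhood in which we trap `w•U`
  obtain ⟨r, hr, hnear⟩ := exists_orbitDist_le_imp_gaugeAct_mem F hJK U₀ (inter_mem (inter_mem hT hN₀) hcont)
  refine ⟨r, hr, fun U hU hUr => ?_⟩
  obtain ⟨w, hw, ⟨⟨hWT, hWN⟩, hWc⟩⟩ := hnear U hUr
  -- `W := w•U` lies in the closed good fibre and, by continuity of the descent, in the fibre
  have hWcl : GaugeField.gaugeAct w U ∈ closure (fibre F ℰp J K hJK V ∩ histGood F ℰp θ K J) := gaugeAct_mem_closure_inter F hJK hw hU
  have hWf : GaugeField.gaugeAct w U ∈ fibre F ℰp J K hJK V :=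
    mem_fibre_of_mem_closure_of_continuousAt F hJK (closure_mono inter_subset_left hWcl) hWc
  -- `W = pivotAct (e z) (σ y)` with `y ∈ s`
  obtain ⟨⟨z, y⟩, ⟨-, hy⟩, hW⟩ := hWT
  dsimp only at hW
  have hk1 : ∀ U'' : GaugeField (F.P K) 0 (Matrix.specialUnitaryGroup (Fin 2) ℂ),
      descendTo F ℰp J K hJK (GaugeField.gaugeAct ((e z).1 : Site (F.P K) 0 → Matrix.specialUnitaryGroup (Fin 2) ℂ) U'') =
        descendTo F ℰp J K hJK U'' := (e z).1.2
  -- `W' := (e z).1⁻¹ • W`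
  obtain ⟨W', hW'⟩ : ∃ W' : GaugeField (F.P K) 0 (Matrix.specialUnitaryGroup (Fin 2) ℂ),
      W' = GaugeField.gaugeAct ((((e z).1 : Site (F.P K) 0 → Matrix.specialUnitaryGroup (Fin 2) ℂ))⁻¹ :
        Site (F.P K) 0 → Matrix.specialUnitaryGroup (Fin 2) ℂ) (GaugeField.gaugeAct w U) := ⟨_, rfl⟩
  have hk1' : ∀ U'' : GaugeField (F.P K) 0 (Matrix.specialUnitaryGroup (Fin 2) ℂ),
      descendTo F ℰp J K hJK (GaugeField.gaugeAct ((((e z).1 : Site (F.P K) 0 → Matrix.specialUnitaryGroup (Fin 2) ℂ))⁻¹ :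
        Site (F.P K) 0 → Matrix.specialUnitaryGroup (Fin 2) ℂ) U'') = descendTo F ℰp J K hJK U'' := residual_inv F hJK hk1
  refine ⟨y, hy, w⁻¹ * ((e z).1 : Site (F.P K) 0 → Matrix.specialUnitaryGroup (Fin 2) ℂ), residual_mul F hJK (residual_inv F hJK hw) hk1, W', ?_, ?_, ?_, ?_,
    ((e z).1 : Site (F.P K) 0 → Matrix.specialUnitaryGroup (Fin 2) ℂ), hk1, ?_⟩
  · rw [hW', gaugeAct_mul_eq, gaugeAct_gaugeAct_inv, gaugeAct_inv_gaugeAct]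
  · rw [hW']; exact (gaugeAct_mem_fibre_iff_of_residual F hJK hk1' _ V).2 hWf
  · rw [hW']; exact gaugeAct_mem_closure_inter F hJK hk1' hWcl
  · intro b hb
    rw [hW']
    apply gaugeAct_inv_apply_of_apply_eq F
    rw [← hW]
    exact pivotAct_apply_of_not_mem_range F hJK _ (e z) (σ y) fun ⟨c, hc⟩ => hb c hc
  · rw [hW', gaugeAct_gaugeAct_inv]; exact hWN

end Core

/-! ## §3 The cover row: edition A (closure-form recognition, chart of record) and edition B (`ChartData`) -/

section Cover

variable {θ : ℕ → ℝ}

/-- ★★★ **THE COVER ROW, EDITION A — ABSTRACT FIBRED CHART WITH CLOSURE-FORM RECOGNITION** (the clause of w3-20520 g14's chart of record ✓`exists_laplaceRows` :154, read at `V`: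
`hrecog`).  Every point of `closure (fibre V ∩ histGood)` at small orbit distance from the residual orbit of `U₀` is a residual transform of `Φ (σ y)` with `y` in any prescribed
neighbourhood of `0`.  Inputs: `hrecog`; `hcont` («`descendTo` continuous near `U₀`», (T2d)); the tube chart `(e, σ)` with surjectivity `𝓝 U₀ ≤ map Θ (𝓝 0)`.
[cite: Balaban1985Variational, Thm 1 (8)-(10) p.279; Balaban1987RG1, (0.4) p.253 and (2.10) p.267; Balaban1985UV3, (12)-(13) p.259] -/
theorem cover_of_recog {V : GaugeField (F.P J) 0 (Matrix.specialUnitaryGroup (Fin 2) ℂ)} {U₀ : GaugeField (F.P K) 0 (Matrix.specialUnitaryGroup (Fin 2) ℂ)}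
    (Φ : GaugeField (F.P K) 0 (Matrix.specialUnitaryGroup (Fin 2) ℂ) → GaugeField (F.P K) 0 (Matrix.specialUnitaryGroup (Fin 2) ℂ))
    (hrecog : ∀ z U', U' ∈ closure (histGood F ℰp θ K J) → descendTo F ℰp J K hJK U' = V →
      (∀ b : PBond (F.P K) 0, (∀ c, iterCentralBond (P := F.P K) (K - J) c ≠ b) → U' b = z b) → Φ z = U')
    (hcont : ∀ᶠ W in 𝓝 U₀, ContinuousAt (descendTo F ℰp J K hJK) W)
    {Z Y : Type*} [TopologicalSpace Z] [Zero Z] [TopologicalSpace Y] [Zero Y]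
    (e : Z → ↥(residualSubgroup F hJK) × (PBond (F.P K) (K - J) → Matrix.specialUnitaryGroup (Fin 2) ℂ))
    (σ : Y → GaugeField (F.P K) 0 (Matrix.specialUnitaryGroup (Fin 2) ℂ))
    (hΘ : 𝓝 U₀ ≤ map (fun p : Z × Y => pivotAct F hJK (iterCentralBond (P := F.P K) (K - J)) (e p.1) (σ p.2)) (𝓝 0)) :
    ∀ s ∈ 𝓝 (0 : Y), ∃ r : ℝ, 0 < r ∧
      ∀ U ∈ closure (fibre F ℰp J K hJK V ∩ histGood F ℰp θ K J),
        (⨅ w' : {w : Site (F.P K) 0 → Matrix.specialUnitaryGroup (Fin 2) ℂ |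
            ∀ U : GaugeField (F.P K) 0 (Matrix.specialUnitaryGroup (Fin 2) ℂ),
              descendTo F ℰp J K hJK (GaugeField.gaugeAct w U) = descendTo F ℰp J K hJK U},
          ∑ ℓ : PBond (F.P K) 0,
            dist1 (U ℓ * ((GaugeField.gaugeAct (w' : Site (F.P K) 0 → Matrix.specialUnitaryGroup (Fin 2) ℂ) U₀) ℓ)⁻¹) ^ 2) ≤ r →
        ∃ y ∈ s, ∃ w : Site (F.P K) 0 → Matrix.specialUnitaryGroup (Fin 2) ℂ,
          (∀ U'' : GaugeField (F.P K) 0 (Matrix.specialUnitaryGroup (Fin 2) ℂ),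
              descendTo F ℰp J K hJK (GaugeField.gaugeAct w U'') = descendTo F ℰp J K hJK U'') ∧
            U = GaugeField.gaugeAct w (Φ (σ y)) := by
  intro s hs
  obtain ⟨r, hr, hcore⟩ := exists_transversal_repr F hJK (θ := θ) (V := V) hcont e σ hΘ univ_mem s hs
  refine ⟨r, hr, fun U hU hUr => ?_⟩
  obtain ⟨y, hy, v, hv, W', hUW', hW'f, hW'cl, hoff, -⟩ := hcore U hU hUr
  refine ⟨y, hy, v, hv, ?_⟩
  rw [hrecog (σ y) W' (closure_mono inter_subset_right hW'cl) hW'f hoff]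
  exact hUW'

variable {α : ℝ} {O : Set (GaugeField (F.P J) 0 (Matrix.specialUnitaryGroup (Fin 2) ℂ))}

/-- ★★★ **THE COVER ROW, EDITION B — A `ChartData` FIBRED CHART** (`Ψ := D.Φ (V, σ ·)`, recognition `ChartData.recog` with windows by ✓`histGood_subset_charted` + ✓`chainWindow_extend`;
needs also `hopen : histGood ∈ 𝓝 U₀`, (T2d)); bonus: the live row `D.jac (V, σ y) ≠ 0`.
[cite: Balaban1985Variational, Thm 1 (8)-(10) p.279; Balaban1987RG1, (0.4) p.253 and (2.10) p.267; Balaban1985UV3, (12)-(13) p.259] -/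
theorem cover_of_chartData (D : ChartData F hJK α (histGood F ℰp θ K J) O) (hθ0 : ∀ i, 0 ≤ θ i)
    (hθα : ∀ i, (((((F.P K).d + 2) * (F.P K).L : ℕ) : ℝ) ^ 2 / 4) * θ i ≤ α)
    {V : GaugeField (F.P J) 0 (Matrix.specialUnitaryGroup (Fin 2) ℂ)} {U₀ : GaugeField (F.P K) 0 (Matrix.specialUnitaryGroup (Fin 2) ℂ)}
    (hcont : ∀ᶠ W in 𝓝 U₀, ContinuousAt (descendTo F ℰp J K hJK) W) (hopen : histGood F ℰp θ K J ∈ 𝓝 U₀)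
    {Z Y : Type*} [TopologicalSpace Z] [Zero Z] [TopologicalSpace Y] [Zero Y]
    (e : Z → ↥(residualSubgroup F hJK) × (PBond (F.P K) (K - J) → Matrix.specialUnitaryGroup (Fin 2) ℂ))
    (σ : Y → GaugeField (F.P K) 0 (Matrix.specialUnitaryGroup (Fin 2) ℂ))
    (hΘ : 𝓝 U₀ ≤ map (fun p : Z × Y => pivotAct F hJK (iterCentralBond (P := F.P K) (K - J)) (e p.1) (σ p.2)) (𝓝 0)) :
    ∀ s ∈ 𝓝 (0 : Y), ∃ r : ℝ, 0 < r ∧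
      ∀ U ∈ closure (fibre F ℰp J K hJK V ∩ histGood F ℰp θ K J),
        (⨅ w' : {w : Site (F.P K) 0 → Matrix.specialUnitaryGroup (Fin 2) ℂ |
            ∀ U : GaugeField (F.P K) 0 (Matrix.specialUnitaryGroup (Fin 2) ℂ),
              descendTo F ℰp J K hJK (GaugeField.gaugeAct w U) = descendTo F ℰp J K hJK U},
          ∑ ℓ : PBond (F.P K) 0,
            dist1 (U ℓ * ((GaugeField.gaugeAct (w' : Site (F.P K) 0 → Matrix.specialUnitaryGroup (Fin 2) ℂ) U₀) ℓ)⁻¹) ^ 2) ≤ r →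
        ∃ y ∈ s, ∃ w : Site (F.P K) 0 → Matrix.specialUnitaryGroup (Fin 2) ℂ,
          (∀ U'' : GaugeField (F.P K) 0 (Matrix.specialUnitaryGroup (Fin 2) ℂ),
              descendTo F ℰp J K hJK (GaugeField.gaugeAct w U'') = descendTo F ℰp J K hJK U'') ∧
            D.jac (V, σ y) ≠ 0 ∧ U = GaugeField.gaugeAct w (D.Φ (V, σ y)) := by
  classical
  intro s hs
  have hk : K - J ≤ (F.P K).m + (F.P K).K := by
    show K - J ≤ F.m + K
    omega
  have hι := iterCentralBond_injective (P := F.P K) hk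
  obtain ⟨r, hr, hcore⟩ := exists_transversal_repr F hJK (θ := θ) (V := V) hcont e σ hΘ hopen s hs
  refine ⟨r, hr, fun U hU hUr => ?_⟩
  obtain ⟨y, hy, v, hv, W', hUW', hW'f, -, hoff, u, hu, huW'⟩ := hcore U hU hUr
  -- `W'` is a good history (a residual translate of it lies in `histGood`)
  have hW'h : W' ∈ histGood F ℰp θ K J := (gaugeAct_mem_histGood_iff F u θ J W').1 huW'
  -- `W'` is `σ y` with its pivots resampled by `W'`'s own pivot values
  have hext : Function.extend (iterCentralBond (P := F.P K) (K - J))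
      (fun c => W' (iterCentralBond (P := F.P K) (K - J) c)) (σ y) = W' := by
    funext b
    by_cases hb : ∃ c, iterCentralBond (P := F.P K) (K - J) c = b
    · obtain ⟨c, rfl⟩ := hb
      rw [hι.extend_apply]
    · rw [Function.extend_apply' _ _ _ hb, hoff b fun c hc => hb ⟨c, hc⟩]
  -- the pivots of `W'` are charted w.r.t. `σ y` (the windows are blind to the pivots)
  have hwin : ∀ c, (fun c => W' (iterCentralBond (P := F.P K) (K - J) c)) c ∈ chainWindow (N := 2) α (K - J) (σ y) c := by
    intro c
    have h1 := histGood_subset_charted F hJK hθ0 hθα hW'h c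
    have h2 : chainWindow (N := 2) α (K - J) W' c = chainWindow (N := 2) α (K - J) (σ y) c := by
      rw [← hext]
      exact chainWindow_extend (N := 2) α hk _ _ c
    rw [h2] at h1
    exact h1
  -- RECOGNITION
  have hrec := D.recog V (σ y) (fun c => W' (iterCentralBond (P := F.P K) (K - J) c)) hwin (by rw [hext]; exact hW'h)
    (by rw [hext]; exact hW'f)
  refine ⟨y, hy, v, hv, hrec.1, ?_⟩
  rw [hrec.2, hext]
  exact hUW'

end Cover

/-! ## §4 POS∘ and TUBE♭ from the growth row along the re-solved transversal (edition A) -/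

section Assembly

variable {γ b₀ p₀ ε₀ : ℝ}

/-- ★★★ **POS∘ ⟸ GROWTH ROW ALONG THE RE-SOLVED TRANSVERSAL** (px8's `hpos` VERBATIM), edition A.  Data: a fibred chart `Φ` with the closure-form recognition row at `V`; the
local row `hcont`; a tube chart `(e, σ)` through `U₀` with the surjectivity row; the re-solved transversal `y ↦ Φ (σ y)` passing through `U₀` with differentiable matrix field at `0`
(✓`contDiffAt_coeField_resolve`); and THE GROWTH ROW along it (⟸ HESS∘ by (T1) `growthRow_of_hessian_pos`).
[cite: Balaban1985Variational, (142) p.299; Balaban1985UV3, (18)-(22) p.260; Balaban1987RG1, (2.10) p.267] -/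
theorem posCollar_of_growthRow_of_recog
    (V : GaugeField (F.P J) 0 (Matrix.specialUnitaryGroup (Fin 2) ℂ)) (U₀ : GaugeField (F.P K) 0 (Matrix.specialUnitaryGroup (Fin 2) ℂ)) (δ : ℝ)
    (Φ : GaugeField (F.P K) 0 (Matrix.specialUnitaryGroup (Fin 2) ℂ) → GaugeField (F.P K) 0 (Matrix.specialUnitaryGroup (Fin 2) ℂ))
    (hrecog : ∀ z U', U' ∈ closure (histGood F ℰp (θBal F.L γ b₀ p₀) K J) → descendTo F ℰp J K hJK U' = V →
      (∀ b : PBond (F.P K) 0, (∀ c, iterCentralBond (P := F.P K) (K - J) c ≠ b) → U' b = z b) → Φ z = U')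
    (hcont : ∀ᶠ W in 𝓝 U₀, ContinuousAt (descendTo F ℰp J K hJK) W)
    {Z : Type*} [TopologicalSpace Z] [Zero Z] {Y : Type*} [NormedAddCommGroup Y] [NormedSpace ℝ Y]
    (e : Z → ↥(residualSubgroup F hJK) × (PBond (F.P K) (K - J) → Matrix.specialUnitaryGroup (Fin 2) ℂ))
    (σ : Y → GaugeField (F.P K) 0 (Matrix.specialUnitaryGroup (Fin 2) ℂ))
    (hΘ : 𝓝 U₀ ≤ map (fun p : Z × Y => pivotAct F hJK (iterCentralBond (P := F.P K) (K - J)) (e p.1) (σ p.2)) (𝓝 0))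
    (hΦ0 : Φ (σ 0) = U₀) (hΦd : DifferentiableAt ℝ (fun y => coeField (Φ (σ y))) 0)
    (hgrow : ∃ c₁ : ℝ, 0 < c₁ ∧ ∀ᶠ y in 𝓝 (0 : Y), c₁ * ‖y‖ ^ 2 ≤ wilsonAction4 (Φ (σ y)) - minActionRegPr F J K hJK ε₀ V) :
    ∃ r c : ℝ, 0 < r ∧ 0 < c ∧
      ∀ U ∈ closure (fibre F ℰp J K hJK V ∩ histGood F ℰp (θBal F.L γ b₀ p₀) K J),
        (∃ w : Site (F.P K) 0 → Matrix.specialUnitaryGroup (Fin 2) ℂ,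
          (∀ U'' : GaugeField (F.P K) 0 (Matrix.specialUnitaryGroup (Fin 2) ℂ),
              descendTo F ℰp J K hJK (GaugeField.gaugeAct w U'') = descendTo F ℰp J K hJK U'') ∧
            ∀ ℓ : PBond (F.P K) 0, dist1 (U ℓ * ((GaugeField.gaugeAct w U₀) ℓ)⁻¹) ≤ δ) →
        (⨅ w : {w : Site (F.P K) 0 → Matrix.specialUnitaryGroup (Fin 2) ℂ |
            ∀ U : GaugeField (F.P K) 0 (Matrix.specialUnitaryGroup (Fin 2) ℂ),
              descendTo F ℰp J K hJK (GaugeField.gaugeAct w U) = descendTo F ℰp J K hJK U},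
          ∑ ℓ : PBond (F.P K) 0,
            dist1 (U ℓ * ((GaugeField.gaugeAct (w : Site (F.P K) 0 → Matrix.specialUnitaryGroup (Fin 2) ℂ) U₀) ℓ)⁻¹) ^ 2) ≤ r →
        c * (⨅ w : {w : Site (F.P K) 0 → Matrix.specialUnitaryGroup (Fin 2) ℂ |
            ∀ U : GaugeField (F.P K) 0 (Matrix.specialUnitaryGroup (Fin 2) ℂ),
              descendTo F ℰp J K hJK (GaugeField.gaugeAct w U) = descendTo F ℰp J K hJK U},
          ∑ ℓ : PBond (F.P K) 0,
            dist1 (U ℓ * ((GaugeField.gaugeAct (w : Site (F.P K) 0 → Matrix.specialUnitaryGroup (Fin 2) ℂ) U₀) ℓ)⁻¹) ^ 2)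
          ≤ wilsonAction4 U - minActionRegPr F J K hJK ε₀ V :=
  posCollar_of_growthRow F hJK V U₀ δ (fun y => Φ (σ y)) hΦ0 hΦd hgrow (cover_of_recog F hJK Φ hrecog hcont e σ hΘ)

/-- ★★★ **TUBE♭(V,U₀) ⟸ GROWTH ROW ALONG THE RE-SOLVED TRANSVERSAL ∧ ISOL∘(δ)**, edition A — ✓px8 `tubeGrowth_of_pos_of_isolated` with its POS∘ letter discharged by
`posCollar_of_growthRow_of_recog`: at the datum, `∃ μ > 0` with `μ·L^{−2(K−J)}·D U ≤ A U − min` for every good history `U` of the fibre in the `δ`-tube about the orbit of `U₀` —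
the body of TUBE-REG∘ with `∃ μ` after `U₀`. [cite: Balaban1985Variational, (142) p.299; Balaban1985UV3, (12)-(13) p.259 and (18)-(22) p.260] -/
theorem tubeGrowth_of_growthRow_of_isolated_of_recog
    (V : GaugeField (F.P J) 0 (Matrix.specialUnitaryGroup (Fin 2) ℂ)) (U₀ : GaugeField (F.P K) 0 (Matrix.specialUnitaryGroup (Fin 2) ℂ)) (δ : ℝ)
    (Φ : GaugeField (F.P K) 0 (Matrix.specialUnitaryGroup (Fin 2) ℂ) → GaugeField (F.P K) 0 (Matrix.specialUnitaryGroup (Fin 2) ℂ))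
    (hrecog : ∀ z U', U' ∈ closure (histGood F ℰp (θBal F.L γ b₀ p₀) K J) → descendTo F ℰp J K hJK U' = V →
      (∀ b : PBond (F.P K) 0, (∀ c, iterCentralBond (P := F.P K) (K - J) c ≠ b) → U' b = z b) → Φ z = U')
    (hcont : ∀ᶠ W in 𝓝 U₀, ContinuousAt (descendTo F ℰp J K hJK) W)
    {Z : Type*} [TopologicalSpace Z] [Zero Z] {Y : Type*} [NormedAddCommGroup Y] [NormedSpace ℝ Y]
    (e : Z → ↥(residualSubgroup F hJK) × (PBond (F.P K) (K - J) → Matrix.specialUnitaryGroup (Fin 2) ℂ))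
    (σ : Y → GaugeField (F.P K) 0 (Matrix.specialUnitaryGroup (Fin 2) ℂ))
    (hΘ : 𝓝 U₀ ≤ map (fun p : Z × Y => pivotAct F hJK (iterCentralBond (P := F.P K) (K - J)) (e p.1) (σ p.2)) (𝓝 0))
    (hΦ0 : Φ (σ 0) = U₀) (hΦd : DifferentiableAt ℝ (fun y => coeField (Φ (σ y))) 0)
    (hgrow : ∃ c₁ : ℝ, 0 < c₁ ∧ ∀ᶠ y in 𝓝 (0 : Y), c₁ * ‖y‖ ^ 2 ≤ wilsonAction4 (Φ (σ y)) - minActionRegPr F J K hJK ε₀ V)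
    (hisol : ∀ U ∈ closure (fibre F ℰp J K hJK V ∩ histGood F ℰp (θBal F.L γ b₀ p₀) K J),
        (∃ w : Site (F.P K) 0 → Matrix.specialUnitaryGroup (Fin 2) ℂ,
          (∀ U'' : GaugeField (F.P K) 0 (Matrix.specialUnitaryGroup (Fin 2) ℂ),
              descendTo F ℰp J K hJK (GaugeField.gaugeAct w U'') = descendTo F ℰp J K hJK U'') ∧
            ∀ ℓ : PBond (F.P K) 0, dist1 (U ℓ * ((GaugeField.gaugeAct w U₀) ℓ)⁻¹) ≤ δ) →
        wilsonAction4 U ≤ minActionRegPr F J K hJK ε₀ V →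
        (⨅ w : {w : Site (F.P K) 0 → Matrix.specialUnitaryGroup (Fin 2) ℂ |
            ∀ U : GaugeField (F.P K) 0 (Matrix.specialUnitaryGroup (Fin 2) ℂ),
              descendTo F ℰp J K hJK (GaugeField.gaugeAct w U) = descendTo F ℰp J K hJK U},
          ∑ ℓ : PBond (F.P K) 0,
            dist1 (U ℓ * ((GaugeField.gaugeAct (w : Site (F.P K) 0 → Matrix.specialUnitaryGroup (Fin 2) ℂ) U₀) ℓ)⁻¹) ^ 2) = 0) :
    ∃ μ : ℝ, 0 < μ ∧ ∀ U ∈ fibre F ℰp J K hJK V, U ∈ histGood F ℰp (θBal F.L γ b₀ p₀) K J →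
      (∃ w : Site (F.P K) 0 → Matrix.specialUnitaryGroup (Fin 2) ℂ,
        (∀ U'' : GaugeField (F.P K) 0 (Matrix.specialUnitaryGroup (Fin 2) ℂ),
            descendTo F ℰp J K hJK (GaugeField.gaugeAct w U'') = descendTo F ℰp J K hJK U'') ∧
          ∀ ℓ : PBond (F.P K) 0, dist1 (U ℓ * ((GaugeField.gaugeAct w U₀) ℓ)⁻¹) ≤ δ) →
      μ * ((F.L : ℝ)⁻¹) ^ (2 * (K - J)) *
          (⨅ w : {w : Site (F.P K) 0 → Matrix.specialUnitaryGroup (Fin 2) ℂ |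
              ∀ U : GaugeField (F.P K) 0 (Matrix.specialUnitaryGroup (Fin 2) ℂ),
                descendTo F ℰp J K hJK (GaugeField.gaugeAct w U) = descendTo F ℰp J K hJK U},
            ∑ ℓ : PBond (F.P K) 0,
              dist1 (U ℓ * ((GaugeField.gaugeAct (w : Site (F.P K) 0 → Matrix.specialUnitaryGroup (Fin 2) ℂ) U₀) ℓ)⁻¹) ^ 2)
        ≤ wilsonAction4 U - minActionRegPr F J K hJK ε₀ V :=
  tubeGrowth_of_pos_of_isolated F hJK V U₀ δ
    (posCollar_of_growthRow_of_recog F hJK V U₀ δ Φ hrecog hcont e σ hΘ hΦ0 hΦd hgrow) hisol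

end Assembly

end Summit.QuantumFields.YangMills.Theorems.FluctuationComparisonRegPrIntLS2BetaPosCollarCoverOfTubeChart

end
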